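import Summits.FinalStateConjecture.FinalStateConjecture.Theorems.BartnikGapSettlingBondiBartnikRigiditySlabFrontier
import Literature.Geometry.Lorentzian.MinkowskiGlobalHyperbolicity
import HarnessLib

/-!
# K2b-5 `stub_marchingLemma`, brick 8: truncated causal pasts in the Kerr star chart — line
# `direct-method-on-the-cone` (crux `BondiBartnikRigidity`, stmt-FinalStateConjecture-10807)

The a-priori bounds on the Kerr-side causal past `J⁻_K(x)` (`K2Route.JKpast`) of a point of the star chart
`Kerr.spacetime M a M` (`0 < M`, `|a| < M`) that discharge the three "past-closed in closed form"
side conditions of `K2Route.ExactChartPastSet` for the domains of the marching: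

* `JKpast_subset` — along the causal past `t*` and the clock `t* + (2/3) r` do not increase and the radius
  stays `≥ min (r(x), r₊)` (`KerrCausal.strictMonoOn_time/clock`, `radius_le_of_radius_lt_rPlus`, read
  through the duality `y ∈ J⁻(x) ↔ x ∈ J⁺(y)`); `closure_JKpast_subset` — the same for the closure;
* `isCompact_closure_JKpast_inter` — `closure J⁻_K(x) ∩ closure J⁺_K(slab)` is compact: it lies in the
  slab `{0 ≤ t* ≤ t*(x), min (r(x), r₊) ≤ r ≤ r(x) + (3/2) t*(x)}` of the chart, a compact set
  (`isCompact_coordSlab`: closed and bounded in `E4` — `‖x⃗‖² ≤ r² + a²` — and inside `{r > M}`);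
* `closure_JKpast_inter_frontier_subset` — `closure J⁻_K(x) ∩ ∂J⁺_K(slab) ⊆ slab ∪ (roofK ∩ {r ≤ ρ})`
  for `ρ ≥ r(x) + (3/2) t*(x)` (`SlabFrontier`, set form).

References: Dafermos–Rodnianski arXiv:0811.0354, §5.1 [DafermosRodnianski2008]; O'Neill 1983, Ch. 14,
p. 402 [ONeill1983]; Hawking–Ellis 1973, §6.5 [HawkingEllis1973CUP].  No definitions, no named facts.
-/

noncomputable section

-- D-0017: single-problem summit, `Summit.<S>.<S>.…` by design (cf. lakefile `weak.linter.dupNamespace`).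
set_option linter.dupNamespace false
set_option maxSynthPendingDepth 3

open Set Filter Function Topology TopologicalSpace
open Literature.Geometry.Lorentzian
open scoped Manifold ContDiff Topology

namespace Summit.FinalStateConjecture.FinalStateConjecture.Theorems.BondiBartnikRigidity.DirectMethod

namespace PastK

open K2Route (JKpast)
open F1Route (self_lt_rPlus)

variable [Kerr.Facts] {M a : ℝ}

/-! ### Monotonicity along the causal past -/

/-- `J⁻_K` in the smooth-metric spelling (by `rfl`). [folklore] -/
theorem JKpast_eq (hM : 0 < M) (S : Set (Kerr.region a M)) :
    JKpast M a hM S = (Kerr.smoothMetric M a M).causalPast ((Kerr.timeOrientation M a M hM.le).ofLE le_top) S :=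
  rfl

/-- Duality: `y ∈ J⁻_K(x) ↔ x ∈ J⁺_K(y)`. [cite: ONeill1983, Ch. 14, p. 402] -/
theorem mem_JKpast_singleton_iff (hM : 0 < M) {x y : Kerr.region a M} :
    y ∈ JKpast M a hM {x} ↔ x ∈ JK M a hM {y} := by
  rw [JKpast_eq, FrontierK.JK_eq]
  exact LorentzianMetric.mem_causalPast_singleton_iff

/-- **A-priori bounds along the causal past**: for `y ∈ J⁻_K(x)` one has `t*(y) ≤ t*(x)`,
`t*(y) + (2/3) r(y) ≤ t*(x) + (2/3) r(x)` and `min (r(x), r₊) ≤ r(y)` (`t*` and the clock increase along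
future causal curves; a future causal curve starting inside `{r < r₊}` never exceeds its initial radius).
[cite: DafermosRodnianski2008, §5.1] -/
theorem JKpast_subset (hM : 0 < M) (ha : |a| < M) (x : Kerr.region a M) :
    JKpast M a hM {x} ⊆ {y | y.1 0 ≤ x.1 0 ∧ y.1 0 + 2 / 3 * Kerr.radius a y.1 ≤ x.1 0 + 2 / 3 * Kerr.radius a x.1 ∧
      min (Kerr.radius a x.1) (Kerr.rPlus M a) ≤ Kerr.radius a y.1} := by
  intro y hy
  rw [mem_JKpast_singleton_iff hM, FrontierK.JK_eq] at hy
  rcases hy with hy | ⟨p, hp, γ, b₀, b₁, hb, hγ, hpa, hyb⟩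
  · rw [mem_singleton_iff] at hy
    rw [hy]
    exact ⟨le_rfl, le_rfl, min_le_left _ _⟩
  · rw [mem_singleton_iff] at hp
    subst hp
    have h0 := KerrCausal.strictMonoOn_time ordConnected_Icc hγ (left_mem_Icc.2 hb.le) (right_mem_Icc.2 hb.le) hb
    have h1 := (KerrCausal.strictMonoOn_clock (c := 2 / 3) (by rw [abs_of_pos (by norm_num)]) ha ordConnected_Icc
      hγ).monotoneOn (left_mem_Icc.2 hb.le) (right_mem_Icc.2 hb.le) hb.le
    simp only [hpa, hyb] at h0 h1
    refine ⟨h0.le, h1, ?_⟩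
    by_cases hlt : Kerr.radius a (γ b₀ : E4) < Kerr.rPlus M a
    · have h2 := KerrCausal.radius_le_of_radius_lt_rPlus ha hγ hlt b₁ (right_mem_Icc.2 hb.le)
      rw [hpa, hyb] at h2
      exact (min_le_left _ _).trans h2
    · rw [hpa] at hlt
      exact (min_le_right _ _).trans (not_lt.1 hlt)

/-- The same bounds for the CLOSURE of the causal past (the three conditions are closed). [folklore] -/
theorem closure_JKpast_subset (hM : 0 < M) (ha : |a| < M) (x : Kerr.region a M) :
    closure (JKpast M a hM {x}) ⊆ {y | y.1 0 ≤ x.1 0 ∧ y.1 0 + 2 / 3 * Kerr.radius a y.1 ≤ x.1 0 + 2 / 3 * Kerr.radius a x.1 ∧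
      min (Kerr.radius a x.1) (Kerr.rPlus M a) ≤ Kerr.radius a y.1} := by
  refine closure_minimal (JKpast_subset hM ha x) ?_
  have h0 := K2Route.continuous_tstar a M
  have hr := K2Route.continuous_radius_region a M
  refine (isClosed_le h0 continuous_const).inter ((isClosed_le (h0.add (hr.const_mul _)) continuous_const).inter
    (isClosed_le continuous_const hr))

/-! ### Compactness of coordinate slabs of the chart -/

omit [Kerr.Facts] in
/-- **Coordinate slabs `{t₁ ≤ t* ≤ t₂, r₁ ≤ r ≤ r₂}` of the chart with `r₁ > max M 0` are compact** (closed and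
bounded in `E4`, and contained in the open chart domain). [folklore] -/
theorem isCompact_coordSlab {r₁ : ℝ} (hr₁ : max M 0 < r₁) (t₁ t₂ r₂ : ℝ) :
    IsCompact {y : Kerr.region a M | t₁ ≤ y.1 0 ∧ y.1 0 ≤ t₂ ∧ r₁ ≤ Kerr.radius a y.1 ∧ Kerr.radius a y.1 ≤ r₂} := by
  set KE : Set E4 := {v | t₁ ≤ v 0 ∧ v 0 ≤ t₂ ∧ r₁ ≤ Kerr.radius a v ∧ Kerr.radius a v ≤ r₂} with hKE
  have h0 : Continuous fun v : E4 => v 0 := PiLp.continuous_apply 2 _ 0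
  have hr : Continuous fun v : E4 => Kerr.radius a v := Kerr.continuous_radius a
  have hcl : IsClosed KE :=
    (isClosed_le continuous_const h0).inter ((isClosed_le h0 continuous_const).inter
      ((isClosed_le continuous_const hr).inter (isClosed_le hr continuous_const)))
  -- `‖x⃗‖² ≤ r² + a²` and `‖x‖² = (x⁰)² + ‖x⃗‖²` (cf. `NecksCertifyBargmann.Seam.spatialNorm_sq_le_kerr_radius_sq_add`,
  -- `E4.norm_sq_eq_time_sq_add` in other routes' files, not importable here)
  have hsp_le : ∀ v : E4, E4.spatialNorm v ^ 2 ≤ Kerr.radius a v ^ 2 + a ^ 2 := fun v => by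
    have h := Kerr.radius_sq a v
    have h2 := Kerr.abs_le_sqrt_radius_discr a v
    have h3 := le_abs_self (E4.spatialNorm v ^ 2 - a ^ 2)
    nlinarith
  have hnorm : ∀ v : E4, ‖v‖ ^ 2 = (v 0) ^ 2 + E4.spatialNorm v ^ 2 := fun v => by
    rw [E4.spatialNorm, EuclideanSpace.real_norm_sq_eq, EuclideanSpace.real_norm_sq_eq, Fin.sum_univ_four,
      Fin.sum_univ_three]
    simp only [E4.spatial_apply]
    show _ = v 0 ^ 2 + (v 1 ^ 2 + v 2 ^ 2 + v 3 ^ 2)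
    ring
  have hbdd : Bornology.IsBounded KE := by
    rw [Metric.isBounded_iff_subset_closedBall (0 : E4)]
    refine ⟨Real.sqrt ((max |t₁| |t₂|) ^ 2 + (r₂ ^ 2 + a ^ 2)), fun v hv => ?_⟩
    obtain ⟨h1, h2, -, h4⟩ := hv
    rw [Metric.mem_closedBall, dist_zero_right]
    refine Real.le_sqrt_of_sq_le ?_
    · rw [hnorm]
      have ht : (v 0) ^ 2 ≤ (max |t₁| |t₂|) ^ 2 := by
        have : |v 0| ≤ max |t₁| |t₂| := by
          rw [abs_le]; constructor
          · linarith [neg_abs_le t₁, le_max_left |t₁| |t₂|]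
          · linarith [le_abs_self t₂, le_max_right |t₁| |t₂|]
        nlinarith [abs_nonneg (v 0), sq_abs (v 0)]
      have hsp := hsp_le v
      have hr2 : Kerr.radius a v ^ 2 ≤ r₂ ^ 2 := pow_le_pow_left₀ (Kerr.radius_nonneg a v) h4 2
      linarith
  have hcpt : IsCompact KE := Metric.isCompact_of_isClosed_isBounded hcl hbdd
  have himg : Subtype.val '' {y : Kerr.region a M | t₁ ≤ y.1 0 ∧ y.1 0 ≤ t₂ ∧ r₁ ≤ Kerr.radius a y.1 ∧
      Kerr.radius a y.1 ≤ r₂} = KE := by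
    ext v
    constructor
    · rintro ⟨y, hy, rfl⟩; exact hy
    · intro hv
      exact ⟨⟨v, lt_of_lt_of_le hr₁ hv.2.2.1⟩, hv, rfl⟩
  exact IsEmbedding.subtypeVal.isCompact_iff.2 (himg ▸ hcpt)

/-! ### The three side conditions -/

/-- **Compactness of truncated pasts**: `closure J⁻_K(x) ∩ closure J⁺_K(slab)` is compact — it lies in the
coordinate slab `{0 ≤ t* ≤ t*(x), min (r(x), r₊) ≤ r ≤ (3/2) t*(x) + r(x)}` (`closure_JKpast_subset` and
`FrontierK.closure_JK_slabK_subset`, with `t* ≥ 0` there). [cite: HawkingEllis1973CUP, §6.5] -/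
theorem isCompact_closure_JKpast_inter (hM : 0 < M) (ha : |a| < M) (x : Kerr.region a M) :
    IsCompact (closure (JKpast M a hM {x}) ∩ closure (JK M a hM (slabK M a))) := by
  have hr₁ : max M 0 < min (Kerr.radius a x.1) (Kerr.rPlus M a) :=
    lt_min x.2 (by rw [max_eq_left hM.le]; exact self_lt_rPlus ha)
  refine (isCompact_coordSlab hr₁ 0 (x.1 0) (3 / 2 * x.1 0 + Kerr.radius a x.1)).of_isClosed_subset
    (isClosed_closure.inter isClosed_closure) ?_
  rintro y ⟨hy1, hy2⟩
  obtain ⟨ht, hcl, hr⟩ := closure_JKpast_subset hM ha x hy1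
  rw [FrontierK.JK_eq] at hy2
  obtain ⟨h0, -⟩ := FrontierK.closure_JK_slabK_subset hM ha hy2
  exact ⟨h0, ht, hr, by linarith⟩

/-- **The frontier condition**: `closure J⁻_K(x) ∩ ∂J⁺_K(slab) ⊆ slab ∪ (roofK ∩ {r ≤ ρ})` whenever
`ρ ≥ r(x) + (3/2) t*(x)` (`SlabFrontier`, set form `hfr`: a frontier point off the slab lies in `J⁺_K(S₃)`,
hence in `roofK`; its radius is bounded by the clock). [cite: HawkingEllis1973CUP, §6.3, Prop. 6.3.1] -/
theorem closure_JKpast_inter_frontier_subset (hM : 0 < M) (ha : |a| < M)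
    (hfr : frontier (JK M a hM (slabK M a)) ⊆ slabK M a ∪ JK M a hM (outerSphereK M a))
    (x : Kerr.region a M) {ρ : ℝ} (hρ : Kerr.radius a x.1 + 3 / 2 * x.1 0 ≤ ρ) :
    closure (JKpast M a hM {x}) ∩ frontier (JK M a hM (slabK M a)) ⊆
      slabK M a ∪ (roofK M a hM ∩ {y | Kerr.radius a y.1 ≤ ρ}) := by
  rintro y ⟨hy1, hy2⟩
  rcases hfr hy2 with h | h
  · exact Or.inl h
  · refine Or.inr ⟨⟨hy2, h⟩, ?_⟩
    obtain ⟨-, hcl, -⟩ := closure_JKpast_subset hM ha x hy1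
    have h0 : 0 ≤ (y : E4) 0 := by
      have := frontier_subset_closure hy2
      rw [FrontierK.JK_eq] at this
      exact (FrontierK.closure_JK_slabK_subset hM ha this).1
    show Kerr.radius a y.1 ≤ ρ
    nlinarith

/-- **Past-closedness of the level domains in closed form**: `closure J⁻_K(x) ∩ W ⊆ W ∩ {t* < τ}` for
`t*(x) < τ`. [folklore] -/
theorem closure_JKpast_inter_subset_lt (hM : 0 < M) (ha : |a| < M) {x : Kerr.region a M} {τ : ℝ}
    (hx : x.1 0 < τ) (S : Set (Kerr.region a M)) :
    closure (JKpast M a hM {x}) ∩ S ⊆ S ∩ {y | y.1 0 < τ} := fun _ hy =>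
  ⟨hy.2, lt_of_le_of_lt (closure_JKpast_subset hM ha x hy.1).1 hx⟩

end PastK

/-- **Registered bookkeeping sub-goal `stub_kerrCoordSlabCompact` of the line** (brick of the landing of
K2b-5 `stub_marchingLemma`): coordinate slabs `{t₁ ≤ t* ≤ t₂, r₁ ≤ r ≤ r₂}` of the Kerr star chart with
`r₁ > max M 0` are compact (anchor of this file, whose content is the a-priori bounds and compactness of
truncated causal pasts, `PastK.closure_JKpast_subset`, `PastK.isCompact_closure_JKpast_inter`,
`PastK.closure_JKpast_inter_frontier_subset`). [folklore] -/
theorem stub_kerrCoordSlabCompact : ∀ (M a r₁ : ℝ), max M 0 < r₁ → ∀ (t₁ t₂ r₂ : ℝ),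
    IsCompact {y : Kerr.region a M | t₁ ≤ y.1 0 ∧ y.1 0 ≤ t₂ ∧ r₁ ≤ Kerr.radius a y.1 ∧ Kerr.radius a y.1 ≤ r₂} :=
  fun _ _ _ hr₁ t₁ t₂ r₂ => PastK.isCompact_coordSlab hr₁ t₁ t₂ r₂

end Summit.FinalStateConjecture.FinalStateConjecture.Theorems.BondiBartnikRigidity.DirectMethod

end
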